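import Mathlib
import HarnessLib
import Summits.HubbardSuperconductivity.HubbardSuperconductivity.Theorems.KLProgrammeKLRegimeTwoVolumeLipChainRows
import Summits.HubbardSuperconductivity.HubbardSuperconductivity.Theorems.KLProgrammeKLRegimeTwoVolumeLipRemeasure
import Summits.HubbardSuperconductivity.HubbardSuperconductivity.Theorems.KLProgrammeKLRegimeTwoVolumeLipDiffSups

/-!
# Route `KLProgramme` — crux K3 ENGINE (stmt-HubbardSuperconductivity-20437), stub (e) proof-input «(e)-D-ROWS», F-D6 IN SUP FORM: THE (Dμ) ROW OF THE
# TWO-VOLUME LIPSCHITZ TOWER IN ABSOLUTE UNITS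
# (seat hubbard-kl-k3c4-p1 g23; `--supports` 20437; DROWS-SCOPE-g23 v5 §9.4 (M1)/(M6))

The deep-pin size of the measured input difference of block `k` (`…TwoVolumeLipDiffDefs.klLipInputDiffSup … d k (n+1) (D₀ + r)`, `2 ≤ d`) is at most the
base size `B₀` (the two-volume difference of `𝒱₀` analysed at `F_{dk−1}`, at `(D₀ + r)`-deep pins) plus, for every earlier block `k′ < k`, the canonical
transfer bound of the jump `F_{dk′} → F_{dk−1}` applied to the born-difference sizes of block `k′`:
`cWⁿ(cW · BD_{k′}(D₀) + τ · BD_{k′}(0)) + (2cWⁿτN_{k′} + n·cWⁿ(5τN_{k′} + 2cW·N^{far}_{k′}))`, `τ = cW/(1 + Λ_T(r+1))`, `BD_{k′}(R) = klLipBornDiffSup … d k′ (n+1) R`.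
This is E1's `klTowerMeasWt_le_remeasured_sum` for DIFFERENCES — the (Dμ) row of T3-Lip₄ in absolute units; the dimensionless reading is (M7).

* `klLipInputDiffSup_le_remeasured` — the displayed bound: `…LipDiffSups.klLipInputDiffSup_le_of_forall` over `…LipRemeasure.sum_pinned_norm_kernel_klLipInputDiff_le_of_parts`
  with each summand bounded by `…LipChainRows.lipRemeasureSummand_le_of_scaleWtRows`, its `E` / `ND` discharged by the suprema
  (`sum_pinned_norm_kernel_bornDiff_le_sup_of_near / _zero`).  Named: the uniform `klScaleWt`-weighted row / column sums `cW` of the fine jump matrices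
  `klJump (bL) … (dk−1) (dk′)` (E1 currency), the coarse born profiles `N k′`, `N^{far} k′` (E1 `klTowerBornWt` rows), and the base size `B₀`.

A composition of landed theorems; nothing asserts the (D) rows, stub (e), VL, K3 or superconductivity.
References: BGM 2006 §2.8 (2.76)–(2.90), §3 (3.2)–(3.8) [cite: BenfattoGiulianiMastropietro2006].
-/

namespace Summit.HubbardSuperconductivity.HubbardSuperconductivity.Theorems.TwoVolumeLip

set_option linter.dupNamespace false -- summit = problem name (single-conjunct summit), D-0017

open Finset Literature.MathematicalPhysics.QuantumLattice GrassmannAlgebra Literature.Probability.LatticeModels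
open Literature.MathematicalPhysics.QuantumLattice.FermiRG
open Summit.HubbardSuperconductivity.HubbardSuperconductivity.Theorems.KLRegimeSplit
open Summit.HubbardSuperconductivity.HubbardSuperconductivity.Theorems.KLProgrammeLegKernels
open Summit.HubbardSuperconductivity.HubbardSuperconductivity.Theorems.DispersionFlow
open Summit.HubbardSuperconductivity.HubbardSuperconductivity.Theorems.EngineV8
open Summit.HubbardSuperconductivity.HubbardSuperconductivity.Theorems.TwoVolumeSource
open Summit.HubbardSuperconductivity.HubbardSuperconductivity.Theorems.TwoVolumeDefect

noncomputable section

variable {L b M : ℕ} [NeZero L] [NeZero (b * L)] [NeZero M]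

/-- **The (Dμ) row in absolute units** — `klLipInputDiffSup … d k (n+1) (D₀ + r) ≤ B₀ + Σ_{k′<k} Transfer(BD_{k′}(D₀), BD_{k′}(0), N_{k′}, N^{far}_{k′})` for
`2 ≤ d`, `0 < β`, `2r ≤ D₀`, a rate `j_r` with `0 ≤ Λ_T ≤ Λ_{j_r}`, uniform `klScaleWt (bL) M β j_r`-weighted row / column sums `≤ cW` of the jump matrices
`klJump (bL) M β μ K (dk−1) (dk′)` (`k′ < k`), coarse born profiles `N k′` (plain) and `N^{far} k′` (`r`-far) in degree `n+1`, and a base size `B₀` of the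
two-volume difference of `𝒱₀` at `(D₀ + r)`-deep pins. -/
theorem klLipInputDiffSup_le_remeasured {β : ℝ} (hβ : 0 < β) (U μ : ℝ) (K : TrigPolyC4v) {d : ℕ} (hd : 2 ≤ d) (k n D₀ r jr : ℕ) (hD₀ : 2 * r ≤ D₀)
    {ΛT cW : ℝ} (hΛT : 0 ≤ ΛT) (hΛr : ΛT ≤ klScale klE0 jr) (hcW : 0 ≤ cW)
    (hrow : ∀ k' ∈ range k, ∀ x, ∑ y', ‖klJump (b * L) M β μ K (d * k - 1) (d * k') x y'‖ *
      klScaleWt (b * L) M β jr {latticeLegPos (2 * (2 * M)) x, latticeLegPos (2 * (2 * M)) y'} ≤ cW)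
    (hcol : ∀ k' ∈ range k, ∀ y', ∑ x, ‖klJump (b * L) M β μ K (d * k - 1) (d * k') x y'‖ *
      klScaleWt (b * L) M β jr {latticeLegPos (2 * (2 * M)) x, latticeLegPos (2 * (2 * M)) y'} ≤ cW)
    {B₀ : ℝ} (hB₀ : 0 ≤ B₀)
    (hbase : ∀ (q : Fin (n + 1)) (w : SpaceTimeIdx (b * L) M × SectorLeg (sectorCount (d * k - 1))), w ∈ klDeepPins L (D₀ + r) →
      ∑ X ∈ univ.filter (fun X : Fin (n + 1) → SpaceTimeIdx (b * L) M × SectorLeg (sectorCount (d * k - 1)) => X q = w),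
        ‖kernel ℂ (sectorPreimage β (klAnisoFamily (b * L) M β μ K klE0 (d * k - 1)) (klEffectiveAction (b * L) M β U μ K klE0 0) -
            klGlue L b M (sectorCount (d * k - 1))
              (sectorPreimage β (klAnisoFamily L M β μ K klE0 (d * k - 1)) (klEffectiveAction L M β U μ K klE0 0))) (n + 1) X‖ ≤ B₀)
    {N Nfar : ℕ → ℝ} (hN0 : ∀ k', 0 ≤ N k') (hNfar0 : ∀ k', 0 ≤ Nfar k')
    (hN : ∀ k' ∈ range k, ∀ (q : Fin (n + 1)) (y : SpaceTimeIdx L M × SectorLeg (sectorCount (d * k'))),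
      ∑ Y ∈ univ.filter (fun Y : Fin (n + 1) → SpaceTimeIdx L M × SectorLeg (sectorCount (d * k')) => Y q = y),
        ‖kernel ℂ (klLipBorn L M β U μ K d k') (n + 1) Y‖ ≤ N k')
    (hNfar : ∀ k' ∈ range k, ∀ (q : Fin (n + 1)) (y : SpaceTimeIdx L M × SectorLeg (sectorCount (d * k'))) (i : Fin (n + 1)),
      ∑ Y ∈ univ.filter (fun Y : Fin (n + 1) → SpaceTimeIdx L M × SectorLeg (sectorCount (d * k')) =>
          Y q = y ∧ r < Torus.tnorm ((Y q).1.2 - (Y i).1.2)), ‖kernel ℂ (klLipBorn L M β U μ K d k') (n + 1) Y‖ ≤ Nfar k') :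
    klLipInputDiffSup L b M β U μ K d k (n + 1) (D₀ + r) ≤
      B₀ + ∑ k' ∈ range k,
        (cW ^ n * (cW * klLipBornDiffSup L b M β U μ K d k' (n + 1) D₀ +
            cW / (1 + ΛT * ((r : ℝ) + 1)) * klLipBornDiffSup L b M β U μ K d k' (n + 1) 0) +
          (2 * cW ^ n * (cW / (1 + ΛT * ((r : ℝ) + 1))) * N k' +
            n * cW ^ n * (5 * (cW / (1 + ΛT * ((r : ℝ) + 1))) * N k' + 2 * cW * Nfar k'))) := by
  have hBD0 : ∀ k' R, 0 ≤ klLipBornDiffSup L b M β U μ K d k' (n + 1) R := fun k' R => klLipBornDiffSup_nonneg β U μ K d k' (n + 1) R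
  refine klLipInputDiffSup_le_of_forall β U μ K d k (n + 1) (D₀ + r) (add_nonneg hB₀ (sum_nonneg fun k' _ => ?_)) fun q w hw => ?_
  · have h1 := hBD0 k' D₀; have h2 := hBD0 k' 0; have h3 := hN0 k'; have h4 := hNfar0 k'
    positivity
  · have hw' : ∀ j, D₀ + r ≤ (w.1.2 j).val % L ∧ (w.1.2 j).val % L + (D₀ + r) < L := mem_klDeepPins.1 hw
    refine sum_pinned_norm_kernel_klLipInputDiff_le_of_parts hβ.ne' U μ K hd k q w (hbase q w hw) fun k' hk' => ?_
    exact lipRemeasureSummand_le_of_scaleWtRows hβ U μ K d k k' jr hΛT hΛr hcW (hrow k' hk') (hcol k' hk') q w D₀ r hD₀ hw' (hN0 k') (hNfar0 k')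
      (hBD0 k' D₀) (hBD0 k' 0) (hN k' hk' q) (hNfar k' hk' q) (fun y' hy' => sum_pinned_norm_kernel_bornDiff_le_sup_of_near β U μ K d k' q hw' y' hy')
      (fun y' => sum_pinned_norm_kernel_bornDiff_le_sup_zero β U μ K d k' q y')

end

end Summit.HubbardSuperconductivity.HubbardSuperconductivity.Theorems.TwoVolumeLip
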